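import Summits.CriticalPhenomena.PercolationContinuityZ3.Theorems.PercNearOneGluingNoHeavyPcintWinKernel
import HarnessLib

/-!
# PCINT lane, kernel window certificates in general dimension — one-pass evaluation of the window tests

Cell `prim-pcint`, seat `prim-pcint-2` (gen 2); memo `run/shared/lean/prim/pcint/REDUCTIONS.md` §R2, INTERVAL-PLAN §14.
Does NOT build on p205010.  The tests of `…PcintWinKernel` (`WinK.okc`, `cc`, `okN`, `gN`, `cN`) recompute the window
positions `posL u a i` inside every filter and test adjacency by constructing all `2d` unit steps (`adjL`); for the
`decide +kernel` checks at `d = 5, 6` this is too slow.  This file gives kernel-cheap versions and proves them EQUAL to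
the originals (so the soundness lemmas `hok`, `hc`, `hokN`, `hgN`, `hcN` transfer verbatim):
* `adjF` — one-pass adjacency of integer lists (exactly one coordinate differs, by `±1`); `adjF_eq_adjL`;
* `scanPos` / `sitesF` — all `m + 3` sites of the extended window in one pass; `sitesF_eq_sites`;
* `okcF`, `ccF`, `okNF`, `gNF`, `cNF` on the precomputed site list; `okcF_eq`, `ccF_eq`, `okNF_eq`, `gNF_eq`, `cNF_eq`.
-/

namespace Summit.CriticalPhenomena.PercolationContinuityZ3.Theorems.Pcint

open Finset Literature.Probability.Percolation Literature.Probability.LatticeModels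

namespace WinK

variable {d m : ℕ}

/-! ### One-pass adjacency -/

/-- One-pass adjacency test of integer lists of equal length: exactly one coordinate differs, by `±1`. [folklore] -/
def adjF : List ℤ → List ℤ → Bool
  | [], [] => false
  | x :: xs, y :: ys => (decide (x = y) && adjF xs ys) || ((decide (y = x + 1) || decide (x = y + 1)) && decide (xs = ys))
  | [], _ :: _ => false
  | _ :: _, [] => false

/-- Adding the unit step `e_i` modifies coordinate `i` by `+1`. [folklore] -/
theorem addL_toL_true {x : List ℤ} (hx : x.length = d) (i : Fin d) : addL x (toL d (i, true)) = x.modify i (· + 1) := by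
  refine List.ext_getElem (by simp [addL, hx]) fun j h1 h2 => ?_
  rw [List.length_modify] at h2
  simp only [addL, List.getElem_zipWith, toL, List.getElem_ofFn, List.getElem_modify]
  by_cases hij : (i : ℕ) = j
  · have : (⟨j, by omega⟩ : Fin d) = i := Fin.ext hij.symm
    simp [this, hij]
  · have : (⟨j, by omega⟩ : Fin d) ≠ i := fun h => hij (by rw [← h])
    simp [this, hij]

/-- Characterisation of `adjF` on lists of equal length. [folklore] -/
theorem adjF_iff : ∀ {x y : List ℤ}, x.length = y.length →
    (adjF x y = true ↔ ∃ k < x.length, y = x.modify k (· + 1) ∨ x = y.modify k (· + 1))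
  | [], [], _ => by simp [adjF]
  | [], _ :: _, h => by simp at h
  | _ :: _, [], h => by simp at h
  | a :: xs, b :: ys, h => by
    have hl : xs.length = ys.length := by simpa using h
    have ih := adjF_iff hl
    simp only [adjF, Bool.or_eq_true, Bool.and_eq_true, decide_eq_true_eq, List.length_cons]
    rw [ih]
    constructor
    · rintro (⟨rfl, k, hk, hk'⟩ | ⟨hab, rfl⟩)
      · refine ⟨k + 1, by omega, ?_⟩
        rcases hk' with h' | h'
        · left; rw [List.modify_succ_cons, ← h']
        · right; rw [List.modify_succ_cons, ← h']
      · refine ⟨0, by omega, ?_⟩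
        rcases hab with rfl | rfl
        · left; simp
        · right; simp
    · rintro ⟨k, hk, hk'⟩
      cases k with
      | zero =>
        simp only [List.modify_zero_cons, List.cons.injEq] at hk'
        rcases hk' with ⟨rfl, rfl⟩ | ⟨rfl, rfl⟩
        · exact Or.inr ⟨Or.inl rfl, rfl⟩
        · exact Or.inr ⟨Or.inr rfl, rfl⟩
      | succ k =>
        simp only [List.modify_succ_cons, List.cons.injEq] at hk'
        rcases hk' with ⟨rfl, h'⟩ | ⟨rfl, h'⟩
        · exact Or.inl ⟨rfl, k, by omega, Or.inl h'⟩
        · exact Or.inl ⟨rfl, k, by omega, Or.inr h'⟩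

/-- **The one-pass test is the adjacency test** (lists of length `d`). [folklore] -/
theorem adjF_eq_adjL {x y : List ℤ} (hx : x.length = d) (hy : y.length = d) : adjF x y = adjL d x y := by
  rw [Bool.eq_iff_iff, adjF_iff (hx.trans hy.symm), adjL, List.any_eq_true]
  constructor
  · rintro ⟨k, hk, h⟩
    refine ⟨⟨k, by omega⟩, List.mem_finRange _, ?_⟩
    simp only [Bool.or_eq_true, decide_eq_true_eq]
    rcases h with h | h
    · left; rw [addL_toL_true hx]; exact h
    · right; rw [addL_toL_true hy]; exact h
  · rintro ⟨i, -, h⟩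
    simp only [Bool.or_eq_true, decide_eq_true_eq] at h
    refine ⟨i, by omega, ?_⟩
    rcases h with h | h
    · left; rw [addL_toL_true hx] at h; exact h
    · right; rw [addL_toL_true hy] at h; exact h

/-! ### All sites in one pass -/

/-- Running positions: `cur`, then the positions after each further step of `L`. [folklore] -/
def scanPos (d : ℕ) : List ℤ → List (Fin d × Bool) → List (List ℤ)
  | cur, [] => [cur]
  | cur, s :: rest => cur :: scanPos d (addL cur (toL d s)) rest

/-- `scanPos` lists the left folds of the prefixes. [folklore] -/
theorem scanPos_eq (d : ℕ) : ∀ (L : List (Fin d × Bool)) (cur : List ℤ),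
    scanPos d cur L = (List.range (L.length + 1)).map fun i => (L.take i).foldl (fun c s => addL c (toL d s)) cur
  | [], cur => by simp [scanPos]
  | s :: rest, cur => by
    rw [scanPos, scanPos_eq d rest, List.length_cons]
    conv_rhs => rw [List.range_succ_eq_map, List.map_cons, List.map_map]
    simp only [List.take_zero, List.foldl_nil]
    congr 1

/-- The sites of the extended window, in one pass. [folklore] -/
def sitesF (u : Fin (m + 1) → Fin d × Bool) (a : Fin d × Bool) : List (List ℤ) :=
  scanPos d (zeroL d) (List.ofFn (wext u a))

/-- Window positions are left folds of the prefixes of the step list. [folklore] -/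
theorem posL_eq_foldl (u : Fin (m + 1) → Fin d × Bool) (a : Fin d × Bool) :
    ∀ {i : ℕ}, i ≤ m + 2 →
      posL u a i = ((List.ofFn (wext u a)).take i).foldl (fun c s => addL c (toL d s)) (zeroL d)
  | 0, _ => by simp [posL]
  | i + 1, hi => by
    have hlt : i < (List.ofFn (wext u a)).length := by simp; omega
    rw [posL, dif_pos (by omega), posL_eq_foldl u a (by omega : i ≤ m + 2), List.take_succ_eq_append_getElem hlt,
      List.foldl_append, List.foldl_cons, List.foldl_nil, List.getElem_ofFn]

/-- **The one-pass site list is the site list.** [folklore] -/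
theorem sitesF_eq_sites (u : Fin (m + 1) → Fin d × Bool) (a : Fin d × Bool) : sitesF u a = sites u a := by
  rw [sitesF, scanPos_eq, sites, List.length_ofFn]
  refine List.map_congr_left fun i hi => ?_
  rw [List.mem_range] at hi
  rw [posL_eq_foldl u a (by omega)]

/-- Length of the site list. [folklore] -/
theorem length_sites (u : Fin (m + 1) → Fin d × Bool) (a : Fin d × Bool) : (sites u a).length = m + 3 := by
  simp [sites]

/-- Entry `j` of a site list (junk `[]` beyond the end). [folklore] -/
def nthP (ps : List (List ℤ)) (j : ℕ) : List ℤ := ps.getD j []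

/-- Entries of the site list are the window positions. [folklore] -/
theorem nthP_sites (u : Fin (m + 1) → Fin d × Bool) (a : Fin d × Bool) {j : ℕ} (hj : j ≤ m + 2) :
    nthP (sites u a) j = posL u a j := by
  rw [nthP, List.getD_eq_getElem?_getD, sites, List.getElem?_map, List.getElem?_range (by omega)]
  rfl

/-- Pointwise-equal predicates give the same `List.all`. [folklore] -/
private theorem all_congr' {α : Type*} {l : List α} {f g : α → Bool} (h : ∀ x ∈ l, f x = g x) :
    l.all f = l.all g := by
  induction l with
  | nil => rfl
  | cons a t ih =>
    rw [List.all_cons, List.all_cons, h a (by simp), ih (fun x hx => h x (by simp [hx]))]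

/-! ### The tests on a precomputed site list -/

/-- Distinct sites. [folklore] -/
def okcF (ps : List (List ℤ)) : Bool := decide (ps.Nodup)

/-- Visible chords. [folklore] -/
def ccF (m : ℕ) (ps : List (List ℤ)) : ℕ :=
  ((Finset.range (m + 1)).filter fun j => adjF (nthP ps j) (nthP ps (m + 2)) = true).card

/-- NAW acceptance. [folklore] -/
def okNF (m : ℕ) (ps : List (List ℤ)) : Bool :=
  okcF ps && (List.range (m + 3)).all fun j => (List.range (j - 1)).all fun i => !adjF (nthP ps i) (nthP ps j)

/-- Gap sites. [folklore] -/
def gapSitesF (d m : ℕ) (ps : List (List ℤ)) : Finset (List ℤ) :=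
  ((univ : Finset (Fin d × Bool)).image fun e => addL (nthP ps (m + 2)) (toL d e)).filter fun w =>
    w ∉ ps ∧ ((List.range m).any fun i => adjF (nthP ps i) w) = true

/-- Gap count. [folklore] -/
def gNF (d m : ℕ) (ps : List (List ℤ)) : ℕ := (gapSitesF d m ps).card

/-- Corner site. [folklore] -/
def cornerF (d m : ℕ) (ps : List (List ℤ)) (a : Fin d × Bool) : List ℤ := addL (nthP ps m) (toL d a)

/-- Corner flag. [folklore] -/
def cNF (d m : ℕ) (ps : List (List ℤ)) (a : Fin d × Bool) : Bool :=
  decide (cornerF d m ps a ∉ ps) && (List.range m).all fun i => !adjF (nthP ps i) (cornerF d m ps a)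

/-- `okcF` on the site list is `okc`. [folklore] -/
theorem okcF_eq (u : Fin (m + 1) → Fin d × Bool) (a : Fin d × Bool) : okcF (sites u a) = okc u a := rfl

/-- `ccF` on the site list is `cc`. [folklore] -/
theorem ccF_eq (u : Fin (m + 1) → Fin d × Bool) (a : Fin d × Bool) : ccF m (sites u a) = cc u a := by
  unfold ccF cc
  congr 1
  refine Finset.filter_congr fun j hj => ?_
  rw [Finset.mem_range] at hj
  rw [nthP_sites u a (by omega), nthP_sites u a le_rfl, adjF_eq_adjL (length_posL u a _) (length_posL u a _)]

/-- `okNF` on the site list is `okN`. [folklore] -/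
theorem okNF_eq (u : Fin (m + 1) → Fin d × Bool) (a : Fin d × Bool) : okNF m (sites u a) = okN u a := by
  unfold okNF okN
  rw [okcF_eq]
  congr 1
  refine all_congr' fun j hj => ?_
  rw [List.mem_range] at hj
  refine all_congr' fun i hi => ?_
  rw [List.mem_range] at hi
  rw [nthP_sites u a (by omega), nthP_sites u a (by omega), adjF_eq_adjL (length_posL u a _) (length_posL u a _)]

/-- `gNF` on the site list is `gN`. [folklore] -/
theorem gNF_eq (u : Fin (m + 1) → Fin d × Bool) (a : Fin d × Bool) : gNF d m (sites u a) = gN u a := by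
  unfold gNF gN gapSitesF gapSitesL
  rw [nthP_sites u a le_rfl]
  congr 1
  refine Finset.filter_congr fun w hw => ?_
  rw [Finset.mem_image] at hw
  obtain ⟨e, -, rfl⟩ := hw
  have hlen : (addL (posL u a (m + 2)) (toL d e)).length = d := length_addL (length_posL u a _) (length_toL _)
  refine and_congr Iff.rfl ?_
  simp only [List.any_eq_true]
  refine exists_congr fun i => and_congr_right fun hi => ?_
  rw [List.mem_range] at hi
  rw [nthP_sites u a (by omega), adjF_eq_adjL (length_posL u a _) hlen]

/-- `cNF` on the site list is `cN`. [folklore] -/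
theorem cNF_eq (u : Fin (m + 1) → Fin d × Bool) (a : Fin d × Bool) : cNF d m (sites u a) a = cN u a := by
  have hc : cornerF d m (sites u a) a = cornerL u a := by rw [cornerF, cornerL, nthP_sites u a (by omega)]
  have hlen : (cornerL u a).length = d := length_addL (length_posL u a _) (length_toL _)
  unfold cNF cN
  rw [hc]
  congr 1
  refine all_congr' fun i hi => ?_
  rw [List.mem_range] at hi
  rw [nthP_sites u a (by omega), adjF_eq_adjL (x := posL u a i) (y := cornerL u a) (length_posL u a _) hlen]

end WinK

end Summit.CriticalPhenomena.PercolationContinuityZ3.Theorems.Pcint
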